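import Literature.MathematicalPhysics.QuantumFieldTheory.Balaban1983to89.Beta.RemainderData190TowerFlat
import Literature.MathematicalPhysics.QuantumFieldTheory.Balaban1983to89.Beta.RemainderOriginTowerDelta2

/-!
# T. Bałaban, *Renormalization group approach to lattice gauge field theories. I*, Commun. Math. Phys. **109** (1987) 249–301 [Balaban1987RG1] p. 282 and
# (4.35) p. 290 ⟵ [Balaban1985Variational] (182) p. 307, (190) p. 308 and [Balaban1985BackgroundPropagators] (3.126) p. 420, (3.132)–(3.138) pp. 422–423:
# **THE (190)-SOCKET `Data190` OF ROW (D4) INHABITED ON THE BOND-FIELD CARRIERS OF THE TOWER IN A BACKGROUND FIELD, WITH BAŁABAN's `Δ⁽²⁾(U)` BUILT IN —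
# `(δ∕δB)𝓗(0) := H₀ + G̃Δ⁽²⁾H₀` of (182) at the origin, `H₀ = H₁,k(U)`, `G̃ = G′ − G′Q_k†(Q_kG′Q_k†)⁻¹Q_kG′`, `G′ = (Δ_{a,k}(U) − Δ⁽²⁾)⁻¹`** — «Y18»
# `Beta.RemainderOriginTowerDelta2.exists_ineq190_origin_tower_delta2` plugged into «Y19» `Beta.RemainderData190TowerFlat.exists_data190_tower_of_ineq190`
# (this lineage gen 115, «Y20»)

CITATION HEADER (lean-in-tree rule 2026-08-18).  Audit cell `pub-balaban`, BINDER row (D4) (`RemainderConst` leaves for Bałaban's split), OWNER lineage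
`b2b-balaban-beta-an4`, gen 115.  Loci exactly as in «Y18» and «Y19» (this lineage): [Balaban1987RG1] ([I]; held `paper:balaban1987-cmp109-rg-i-small-field`)
(4.4) p. 281, p. 282, (4.35) p. 290; [Balaban1985Variational] ([15]; `paper:balaban1985-cmp102-variational-background`) (129)–(131) pp. 297–298, (180) p. 306,
(182) p. 307, (190) p. 308; [Balaban1985BackgroundPropagators] ([5]; `paper:balaban1985-cmp99-background-propagators`) (3.11) p. 392, (3.15) p. 393, (3.35)–(3.37)
p. 396, Thm 3.1 (3.42) p. 397, Thm 3.3 p. 399, Thm 3.11 p. 416, (3.126) p. 420, (3.132)–(3.138) pp. 422–423; [Balaban1985Averaging] ([4]) (52) p. 26, (136)–(138)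
p. 39, (145) p. 39, (149) p. 40, (155) p. 41; [Balaban1984PropagatorsII] ([3]) (2.46) p. 231, (2.51)–(2.52) p. 232, Lemma 2.1 (2.61) p. 234.  Composed BY NAME:
«Y18» (whose merged binder block — ne9-leaf-05's (K81) `B9Eq3126H1kPiSupRowClosed` + «Y13a» — is repeated VERBATIM, one copy per volume) and «Y19» §3.
Nothing of print is asserted here.

WHY THIS FILE («Y20»).  «Y19» inhabited the (190)-socket `Beta.RemainderDecay190.Data190` of the k-uniform remainder chain on the bond-field carriers of NE9's
tower GENERICALLY in the derivative family (`exists_data190_tower_of_ineq190`) and plugged the ZERO-BACKGROUND derivative `H₁,k(1)`.  «Y18» is NODE D at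
the origin IN A BACKGROUND FIELD with Bałaban's `Δ⁽²⁾(U)` of [5] (3.134)∕(3.136) built in: under the (K81)+«Y13a» binder block (the diagonal, weights, the
background `U` with `star U = U⁻¹` in print's windows (3.35) and the current window (3.36) `‖J‖ ≤ j₀`, the consumer's regularity display ∕ level profile ∕
transporters ∕ positivity and onto witnesses, rates, the derived constants at their closed forms, the two smallnesses in `j₀`) THERE ARE `Δ⁽²⁾`,
`G′ = (Δ_{a,k}(U) − Δ⁽²⁾)⁻¹` and `(Q_kG′Q_k†)⁻¹` two-sided with `∀ δ′, δ′∕8 ≤ ρ → Ineq190 S^{coarse} S^{fine} (H₀ + G̃Δ⁽²⁾H₀) (A₀ + B_G̃θ_Dc) δ′`.  THIS FILE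
plugs «Y18» into the socket: **`exists_data190_tower_delta2`** — `∃ (α⋆, B, δ, A′, r₁, α₁, j₁, Λ)` FIRST («Y18»'s); then for every height `k` (diagonal,
weights, `c₀ = η^d`), cube side `M`, volume sequence `N`, size index set `I ∋ i₀`, geometry weights, source `(μ₀, w₀)`, and — PER VOLUME `n` — a background
`U n` on the fine torus above the unit lattice with `N n·M` sites per direction together with its copy of «Y18»'s binder block (one `α ≤ min(α⋆, α₁)` and one
current bound `j₀ ≤ j₁` for all volumes), rates `ρ + 5σ ≤ min(δ, r₁)∕d`, the derived constants with `q, q_I < 1`, and a constant record `q′ : Consts190` under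
NUMERICS ONLY (`0 < q′.σ`, `δr > 0` with `c₀(δr, q′.σ∕δr)^d ≤ q′.cR`, `1 ≤ q′.κB`, `q′.δ15 ≤ 8ρ`, `A₀ + B_G̃θ_Dc ≤ q′.Cst`, `‖w₀‖ ≤ q′.m`, `q′.θ ≤ 1`):
THERE ARE families `Δ⁽²⁾ n`, `G′ n`, `Inv′ n` WITH «Y18»'s two-sided inverse relations on every volume, the derivative family
`T n := (H₁,k(U n) + G̃ nΔ⁽²⁾ nH₁,k(U n))ᵉ↾ℝ` (its formula exported), AND `∃ D : Data190 d M N (fun n => Bond d (towerP L (N n·M)^d (k+1)) → W) q′` with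
`dHn := T` and the (4.35) computation rule `D.hn n X̄ x = (b ↦ [unit-lattice site below b ∈ a cube of X̄] ? (T n (δ_{(ê x, μ₀)}·w₀))(b) : 0)`.  Mechanism: «Y18»
per volume, `choose`, `HasMaj.mono` on the constant, «Y19» §3.

HONEST SCOPE.  [folklore] plumbing: «Y18» ∘ «Y19» §3; NO estimate of [5], [15], [3], [4] or [I] is proved here.  A MODEL instance of NODE D of row (D4) on the
one-domain tower `Ω_k = T_η` of NE9's carriers (ONE level `j = k`; value line of (190) only; one unit source per unit-lattice site), EVERY operator Bałaban's on
that model, the backgrounds `U n` and their displays ∕ witnesses the CONSUMER's (admissible ones exist on print's class: «Y12a» `letters_of_windows`, the NE9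
cell's Thm 3.11 theorems; not derived here), the smallnesses `q, q_I < 1` conditions on print's (3.36) window `j₀`; NOT Bałaban's multiscale `{Ω_j}`∕`𝔅`
setting, NOT `Δ⁽²⁾_π` (3.135), NOT (3.138), NOT (189), NOT the other leaves of `PolLeavesT190` (`han`, `hrepr`, the seam, [II]'s (2.38), (5.1)).  Row (D4) class
UNCHANGED (instance 0∕1; critical-path width 0 = NODE O; D4 DISCHARGE NO DATE); NOT B12 Thm 2, NOT BetaPertH, NOT continuum, NOT Clay.  HONEST DEPENDENCY (cell
line): continuum YM on T⁴ ⇐ BetaPertH ∧ nine spine estimates (0/9 proved); BetaPertH ⇐ (D1) ∧ (D4) ∧ CAP+tail; G-an2-4 gates asym, D1 and NE2/3/4.  NEW file;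
nothing modified; 0 `def`; standard axioms; no `sorry`; default heartbeats.  Net new unproved facts: 0.
-/

noncomputable section

set_option autoImplicit false

open scoped BigOperators InnerProductSpace ComplexConjugate

namespace Literature.MathematicalPhysics.QuantumFieldTheory.Balaban1983to89.Beta.RemainderData190TowerDelta2

open B11SectG B11SupSize190 open B9Eq311L2Pairing (WL2) open B4Sect5Torus (TSite) open B4Sect5Proof (latticeConst) open B5TorusCover (UT)
open B9Thm34Ext (toB6) open B9Thm37GlueTorus (torusGeom tdist1) open B9SectCLatticeCarrier (Bond bpos unshift) open B9Eq319QprimeTorus (blockCoord)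
open B7Prop1Explicit (U1 Wcx boxVec) open B7Prop2Explicit (C0 c2') open B7Prop3Flat (c3) open B7Prop5GeneralLevels (thetaGen C3Gen)
open B11Eq103H1Complex (SiteL2K BondL2K) open B9Eq310DeltaPrime (plaqHolU) open B9Eq310HessianOperator (adTransportW)
open B9Eq315QTorus (perCfg cornerSite) open B9Eq315QTower (towerP UlevOf) open B9Eq316TowerFlatIsOneStep (towerP_eq_fineP_pow siteCast)
open B9Eq326OperatorTower (QkW laplaceAk H1k) open B9Eq324DeltaPrimeATower (laplacePrimeAk) open B9Eq3119DeltaPiTower (laplaceAkPi)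
open TreeLengthTorus (TPt TDom) open B12Decay510Torus (tcubeOf) open Beta.RemainderDecay190 (Data190 Consts190)
open Beta.RemainderOriginTowerDelta2 (exists_ineq190_origin_tower_delta2) open Beta.RemainderData190TowerFlat (exists_data190_tower_of_ineq190)

section Tower

variable {d : ℕ} (hd : 1 ≤ d) (L : ℕ) [NeZero L] (hL : 1 ≤ L) (hL3 : 3 ≤ L)
  {𝔸 : Type*} [CStarAlgebra 𝔸] [Nontrivial 𝔸]
  {W : Type} [NormedAddCommGroup W] [InnerProductSpace ℂ W] [FiniteDimensional ℂ W] (φ : W ≃ₗ[ℂ] 𝔸)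
  {Mφ Mφ' : ℝ} (hMφ : 0 ≤ Mφ) (hMφ' : 0 ≤ Mφ') (hφ : ∀ w, ‖φ w‖ ≤ Mφ * ‖w‖) (hφ' : ∀ X, ‖φ.symm X‖ ≤ Mφ' * ‖X‖) (hstar : ∀ X : 𝔸, ‖star X‖ ≤ ‖X‖)
  {a : ℝ} (ha : 0 < a) {a' : ℝ} (ha' : 0 < a') {ϱ : ℝ} (hϱ0 : 0 ≤ ϱ) (hϱ1 : ϱ < 1)
  (τ : 𝔸 →ₗ[ℂ] ℂ) {Cτ : ℝ} (hτ : ∀ X, ‖τ X‖ ≤ Cτ * ‖X‖) (hCτ : 0 ≤ Cτ) {Mτ : ℝ} (hτm : ∀ X Y : 𝔸, ‖τ (X * Y)‖ ≤ Mτ * ‖X‖ * ‖Y‖) (hMτ : 0 ≤ Mτ)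
  {ρw : ℝ} (hρw : 0 ≤ ρw)
  (hτ₁ : ∀ X : 𝔸, τ (star X) = conj (τ X)) (hτ₂ : ∀ X Y : 𝔸, τ (X * Y) = τ (Y * X)) (hφτ : ∀ X Y : 𝔸, ⟪φ.symm X, φ.symm Y⟫_ℂ = τ (star X * Y))
  (AQ : ℝ)
  (hAQ16 : 16 * ((d : ℝ) + 1) * ((d : ℝ) + 4) * c2' d L ≤ AQ)
  {α₀ β : ℝ} (hα : 0 < α₀) (hα3 : C0 d * α₀ ≤ 1 / 3) (hα4 : 4 * α₀ ≤ c2' d L) (hβ : 0 < β)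
  (hsmall : Real.exp (4 * (800 * ((d : ℝ) + 1) ^ 2 * ((d : ℝ) + 4)) * α₀) * (1 + 8 * (131072 * ((d : ℝ) + 1) ^ 2) * β) ≤ 2)
  (hc₃ : 4 * β < c3 d L)
  (h145 : 8 * d * thetaGen d L α₀ * (L : ℝ)⁻¹ ^ 4 ≤ 1)
  (h155 : (2 * (L : ℝ) - 1) * (L : ℝ)⁻¹ ^ 2 + 2 * d * thetaGen d L α₀ * (L : ℝ)⁻¹ ^ 3
    + 1 / 8 * (1 + 2 * d * thetaGen d L α₀ * (L : ℝ)⁻¹ ^ 2 + 2 * d * C3Gen d L * β) * (L : ℝ)⁻¹ ^ 2 ≤ 1)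

include hd hL hL3 hMφ hMφ' hφ hφ' hstar ha ha' hϱ0 hϱ1 hτ hCτ hτm hMτ hρw hτ₁ hτ₂ hφτ hAQ16 hα hα3 hα4 hβ hsmall hc₃ h145 h155 in
/-- **THE (190)-SOCKET OF ROW (D4) INHABITED IN A BACKGROUND FIELD WITH BAŁABAN's `Δ⁽²⁾(U)` BUILT IN** — see the module docstring: «Y18»'s `∃ (α⋆, B, δ, A′, r₁,
α₁, j₁, Λ)` first; under one copy of «Y18»'s binder block per volume `n` (background `U n`, the consumer's display ∕ witnesses), the rates, the derived constants
with the two smallnesses in `j₀`, and NUMERICS on the constant record `q′`: families `Δ⁽²⁾ n`, `G′ n = (Δ_{a,k}(U n) − Δ⁽²⁾ n)⁻¹`, `Inv′ n = (Q_kG′ nQ_k†)⁻¹`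
(two-sided), the derivative family `T n = (H₁,k(U n) + G̃ nΔ⁽²⁾ nH₁,k(U n))ᵉ↾ℝ` of [15] (182) at the origin, and `D : Data190 d M N (fine bond fields) q′` with
`dHn := T` and the (4.35) computation rule. [cite: Balaban1987RG1, (4.4) p.281, p.282, (4.35) p.290] [cite: Balaban1985Variational, (182) p.307, (190) p.308,
(129)–(131) pp.297–298, (180) p.306] [cite: Balaban1985BackgroundPropagators, (3.134)–(3.138) pp.422–423, (3.126) p.420, (3.132)–(3.133) p.422, Thm 3.11 p.416,
(3.35)–(3.37) p.396] [cite: Balaban1985Averaging, (136)–(138) p.39, (149) p.40, (52) p.26] [cite: Balaban1984PropagatorsII, (2.51)–(2.52) p.232, Lemma 2.1 (2.61) p.234] -/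
theorem exists_data190_tower_delta2 :
    ∃ αs B δ A' r₁ α₁ j₁ Λ : ℝ, 0 < αs ∧ 0 ≤ B ∧ 0 < δ ∧ 0 ≤ A' ∧ 0 < r₁ ∧ 0 < α₁ ∧ 0 < j₁ ∧ 0 ≤ Λ ∧
      ∀ (k : ℕ) (η : ℝ) (_hηL : η * (L : ℝ) ^ (k + 1) = 1) (c₀ c₁ : ℝ) [Fact (0 < c₀)] [Fact (0 < c₁)]
        (_hw : c₀ * ((L : ℝ) ^ (k + 1)) ^ d = c₁) (_hρ : |η| ^ d / c₀ ≤ ρw) (_hc₀η : c₀ = η ^ d)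
        (M : ℕ) [NeZero M] (N : ℕ → ℕ) [∀ n, NeZero (N n)] (I : Type) (_i₀ : I) (μ₀ : Fin d) (w₀ : W)
        -- PER VOLUME `n`: the background on the fine torus above the unit lattice with `N n·M` sites per direction and its copy of «Y18»'s binder block
        (U : (n : ℕ) → Bond d (towerP L (fun _ : Fin d => N n * M) (k + 1)) → 𝔸ˣ)
        (αU : ℕ → ℕ → ℝ) (_hα0 : ∀ n j, 0 ≤ αU n j) (hα1 : ∀ n j, αU n j ≤ 1 / 64) (hαL : ∀ n j, 50 * (d + 1) * αU n j * (L : ℝ) ^ d ≤ 1 / 2)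
        (hU1 : ∀ (n j : ℕ) (x : B7Prop1Explicit.Site d) (κ : Fin d), perCfg (towerP L (fun _ : Fin d => N n * M) (j + 1)) (UlevOf L (fun _ : Fin d => N n * M) (k + 1) (U n) j) x κ ∈ U1 𝔸)
        (hreg : ∀ (n j : ℕ) (y : TSite d (towerP L (fun _ : Fin d => N n * M) j)) (κ : Fin d) (ρ' : Fin d → Fin L),
          ‖((Wcx L (perCfg (towerP L (fun _ : Fin d => N n * M) (j + 1)) (UlevOf L (fun _ : Fin d => N n * M) (k + 1) (U n) j)) (cornerSite L y) κ (boxVec L ρ') : 𝔸ˣ) : 𝔸) - 1‖ ≤ αU n j)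
        (εU : ℕ → ℕ → ℝ) (_hεU : ∀ n j, 0 ≤ εU n j)
        (_hUε : ∀ (n j : ℕ) (b : Bond d (towerP L (fun _ : Fin d => N n * M) (j + 1))), ‖(UlevOf L (fun _ : Fin d => N n * M) (k + 1) (U n) j b : 𝔸) - 1‖ ≤ εU n j)
        (_hLb : ∀ (n j : ℕ) (b : Bond d (towerP L (fun _ : Fin d => N n * M) (j + 1))), UlevOf L (fun _ : Fin d => N n * M) (k + 1) (U n) j b ∈ U1 𝔸)
        (α : ℝ) (_hα : 0 ≤ α) (_hαle : α ≤ α₁) (_hαs : α ≤ αs)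
        (hUst : ∀ n b, star (U n b : 𝔸) = (((U n b)⁻¹ : 𝔸ˣ) : 𝔸)) (_hUb : ∀ n b, U n b ∈ U1 𝔸) (_hUη : ∀ n b, ‖(U n b : 𝔸) - 1‖ ≤ α * η)
        (_hpl : ∀ n (p : B9SectCLatticeCarrier.Plaq d (towerP L (fun _ : Fin d => N n * M) (k + 1))), ‖(plaqHolU (U n) p : 𝔸) - 1‖ ≤ α * η ^ 2)
        (_hUgrad : ∀ n (x : TSite d (towerP L (fun _ : Fin d => N n * M) (k + 1))) (μ : Fin d), ‖(U n (x, μ) : 𝔸) - U n (unshift μ x, μ)‖ ≤ α * η ^ 2)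
        (_hRlev : ∀ (n j : ℕ) (b : Bond d (towerP L (fun _ : Fin d => N n * M) (j + 1))) (w : W), ‖adTransportW φ (UlevOf L (fun _ : Fin d => N n * M) (k + 1) (U n) j) b w‖ ≤ ‖w‖)
        (_hεg : ∀ n, ∀ j < k + 1, εU n j ≤ α * ϱ ^ j) (_hAQ : ∀ n, ∑ j ∈ Finset.range (k + 1), αU n j ≤ AQ)
        (hpos' : ∀ n (x : SiteL2K ℂ d (towerP L (fun _ : Fin d => N n * M) (k + 1)) c₀ W), x ≠ 0 → 0 < RCLike.re ⟪x, laplacePrimeAk L (fun _ : Fin d => N n * M) k φ η (U n) a' (c₁ := c₁) x⟫_ℂ)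
        (hpos : ∀ n (x : BondL2K ℂ d (towerP L (fun _ : Fin d => N n * M) (k + 1)) c₀ W), x ≠ 0 →
          0 < RCLike.re ⟪x, laplaceAk L (fun _ : Fin d => N n * M) k φ η (U n) hL (αU n) (hα1 n) (hU1 n) (hreg n) τ (c₀ := c₀) (c₁ := c₁) a x⟫_ℂ)
        (j₀ : ℝ) (_hJ : ∀ n μ y, ‖B9Eq39Adjoint.J (fun μ => B9Eq33CovDerivVector.shiftEquiv μ) (fun μ y => U n (y, μ)) η μ y‖ ≤ j₀) (_hj : j₀ ≤ j₁)
        (hposπ : ∀ n (x : BondL2K ℂ d (towerP L (fun _ : Fin d => N n * M) (k + 1)) c₀ W), x ≠ 0 →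
          0 < RCLike.re ⟪x, laplaceAkPi L (fun _ : Fin d => N n * M) k φ τ η (U n) a' (hpos' n) hL (αU n) (hα1 n) (hU1 n) (hreg n) (c₁ := c₁) a x⟫_ℂ)
        (hQ : ∀ n, Function.Surjective (QkW L (fun _ : Fin d => N n * M) k φ (U n) hL (αU n) (hα1 n) (hU1 n) (hreg n) (c₀ := c₀) (c₁ := c₁)))
        (η₀ L₀ M₀ R : ℕ → ℝ) (H : ℕ → Prop)
        -- the rates and the (free) row-sum constant (as in «Y18»)
        (ρ σ c : ℝ) (_hσ : 0 < σ) (_hρ0 : 0 ≤ ρ) (_hρ₁ : ρ + 5 * σ ≤ δ / d) (_hρI : ρ + 5 * σ ≤ r₁ / d) (_hc_def : c = B6.c0 1 σ ^ d)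
    -- the derived constants at their closed forms (instantiate with `rfl`) and the TWO smallnesses in `j₀` (as in «Y18»)
    {qN BG' θP qI BI' A₀ θD BGt : ℝ}
    (hq_def : qN = B * ((Λ * j₀) * Real.exp (σ * d) * c) * Real.exp (δ / d * d) * c) (hq : qN < 1) (hBG' : BG' = B * (1 - qN)⁻¹)
    (hθP : θP = B * ((Λ * j₀) * Real.exp (σ * d) * c) * Real.exp (δ / d * d) * BG' * c *
      ((Mφ' * Real.exp (100 * d * (d + 1) * (L : ℝ) ^ d * AQ) * Mφ * ((2 * d : ℕ) : ℝ)) * Real.exp 1 * latticeConst d 1) *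
      Real.exp ((ρ + 4 * σ) * d) * ((Mφ' * Mφ * Real.exp (50 * (d + 1) * AQ)) * Real.exp 1 * latticeConst d 1) *
      Real.exp ((ρ + 4 * σ) * d))
    (hqI : qI = A' * θP * c * c) (hqI1 : qI < 1) (hBI' : BI' = A' * (1 - qI)⁻¹)
    (hA₀ : A₀ = B * ((Mφ' * Real.exp (100 * d * (d + 1) * (L : ℝ) ^ d * AQ) * Mφ * ((2 * d : ℕ) : ℝ)) * Real.exp 1 *
      latticeConst d 1) * Real.exp δ * A' * c)
    (hθD : θD = A₀ * ((Λ * j₀) * Real.exp (σ * d) * c) * Real.exp (ρ * d))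
    (hBGt : BGt = BG' + ((Mφ' * Mφ * Real.exp (50 * (d + 1) * AQ)) * Real.exp 1 * latticeConst d 1) *
      ((Mφ' * Real.exp (100 * d * (d + 1) * (L : ℝ) ^ d * AQ) * Mφ * ((2 * d : ℕ) : ℝ)) * Real.exp 1 * latticeConst d 1) *
      BI' * BG' * BG' * Real.exp ((ρ + 2 * σ) * d) * Real.exp ((ρ + 2 * σ) * d) * c * c)
    -- the socket's constant record: numerics only
    (q' : Consts190) (δr : ℝ) (_hδr : 0 < δr) (_hσ₀ : 0 < q'.σ) (_hcR : B6.c0 δr (q'.σ / δr) ^ d ≤ q'.cR) (_hκB : 1 ≤ q'.κB)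
    (_hδ15 : q'.δ15 ≤ 8 * ρ) (_hCst : A₀ + BGt * θD * c ≤ q'.Cst) (_hm : ‖w₀‖ ≤ q'.m) (_hθ1 : q'.θ ≤ 1),
    ∃ (D2 : (n : ℕ) → BondL2K ℂ d (towerP L (fun _ : Fin d => N n * M) (k + 1)) c₀ W →ₗ[ℂ] BondL2K ℂ d (towerP L (fun _ : Fin d => N n * M) (k + 1)) c₀ W)
      (G' : (n : ℕ) → (Bond d (towerP L (fun _ : Fin d => N n * M) (k + 1)) → W) →L[ℂ] (Bond d (towerP L (fun _ : Fin d => N n * M) (k + 1)) → W))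
      (Inv' : (n : ℕ) → (Bond d (fun _ : Fin d => N n * M) → W) →L[ℂ] (Bond d (fun _ : Fin d => N n * M) → W))
      (T : (n : ℕ) → (Bond d (fun _ : Fin d => N n * M) → W) →ₗ[ℝ] (Bond d (towerP L (fun _ : Fin d => N n * M) (k + 1)) → W)),
      (∀ n : ℕ,
      -- `G′ = (Δ_{a,k}(U) − Δ⁽²⁾)⁻¹`, two-sided
      G' n * (LinearMap.toContinuousLinearMap
          ((WL2.linearEquiv ℂ ℂ (fun _ : Bond d (towerP L (fun _ : Fin d => N n * M) (k + 1)) => c₀) :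
              BondL2K ℂ d (towerP L (fun _ : Fin d => N n * M) (k + 1)) c₀ W ≃ₗ[ℂ] (Bond d (towerP L (fun _ : Fin d => N n * M) (k + 1)) → W)).toLinearMap ∘ₗ
            laplaceAk L (fun _ : Fin d => N n * M) k φ η (U n) hL (αU n) (hα1 n) (hU1 n) (hreg n) τ (c₀ := c₀) (c₁ := c₁) a ∘ₗ
            (WL2.linearEquiv ℂ ℂ (fun _ : Bond d (towerP L (fun _ : Fin d => N n * M) (k + 1)) => c₀) :
              BondL2K ℂ d (towerP L (fun _ : Fin d => N n * M) (k + 1)) c₀ W ≃ₗ[ℂ] (Bond d (towerP L (fun _ : Fin d => N n * M) (k + 1)) → W)).symm.toLinearMap) -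
        LinearMap.toContinuousLinearMap
          ((WL2.linearEquiv ℂ ℂ (fun _ : Bond d (towerP L (fun _ : Fin d => N n * M) (k + 1)) => c₀) :
              BondL2K ℂ d (towerP L (fun _ : Fin d => N n * M) (k + 1)) c₀ W ≃ₗ[ℂ] (Bond d (towerP L (fun _ : Fin d => N n * M) (k + 1)) → W)).toLinearMap ∘ₗ D2 n ∘ₗ
            (WL2.linearEquiv ℂ ℂ (fun _ : Bond d (towerP L (fun _ : Fin d => N n * M) (k + 1)) => c₀) :
              BondL2K ℂ d (towerP L (fun _ : Fin d => N n * M) (k + 1)) c₀ W ≃ₗ[ℂ] (Bond d (towerP L (fun _ : Fin d => N n * M) (k + 1)) → W)).symm.toLinearMap)) = 1 ∧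
      (LinearMap.toContinuousLinearMap
          ((WL2.linearEquiv ℂ ℂ (fun _ : Bond d (towerP L (fun _ : Fin d => N n * M) (k + 1)) => c₀) :
              BondL2K ℂ d (towerP L (fun _ : Fin d => N n * M) (k + 1)) c₀ W ≃ₗ[ℂ] (Bond d (towerP L (fun _ : Fin d => N n * M) (k + 1)) → W)).toLinearMap ∘ₗ
            laplaceAk L (fun _ : Fin d => N n * M) k φ η (U n) hL (αU n) (hα1 n) (hU1 n) (hreg n) τ (c₀ := c₀) (c₁ := c₁) a ∘ₗ
            (WL2.linearEquiv ℂ ℂ (fun _ : Bond d (towerP L (fun _ : Fin d => N n * M) (k + 1)) => c₀) :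
              BondL2K ℂ d (towerP L (fun _ : Fin d => N n * M) (k + 1)) c₀ W ≃ₗ[ℂ] (Bond d (towerP L (fun _ : Fin d => N n * M) (k + 1)) → W)).symm.toLinearMap) -
        LinearMap.toContinuousLinearMap
          ((WL2.linearEquiv ℂ ℂ (fun _ : Bond d (towerP L (fun _ : Fin d => N n * M) (k + 1)) => c₀) :
              BondL2K ℂ d (towerP L (fun _ : Fin d => N n * M) (k + 1)) c₀ W ≃ₗ[ℂ] (Bond d (towerP L (fun _ : Fin d => N n * M) (k + 1)) → W)).toLinearMap ∘ₗ D2 n ∘ₗ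
            (WL2.linearEquiv ℂ ℂ (fun _ : Bond d (towerP L (fun _ : Fin d => N n * M) (k + 1)) => c₀) :
              BondL2K ℂ d (towerP L (fun _ : Fin d => N n * M) (k + 1)) c₀ W ≃ₗ[ℂ] (Bond d (towerP L (fun _ : Fin d => N n * M) (k + 1)) → W)).symm.toLinearMap)) * G' n = 1 ∧
      -- `Inv′ = (Q_kG′Q_k†)⁻¹`, two-sided
      Inv' n * ((LinearMap.toContinuousLinearMap
          ((WL2.linearEquiv ℂ ℂ (fun _ : Bond d (fun _ : Fin d => N n * M) => c₁) : BondL2K ℂ d (fun _ : Fin d => N n * M) c₁ W ≃ₗ[ℂ] (Bond d (fun _ : Fin d => N n * M) → W)).toLinearMap ∘ₗ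
            QkW L (fun _ : Fin d => N n * M) k φ (U n) hL (αU n) (hα1 n) (hU1 n) (hreg n) (c₀ := c₀) (c₁ := c₁) ∘ₗ
            (WL2.linearEquiv ℂ ℂ (fun _ : Bond d (towerP L (fun _ : Fin d => N n * M) (k + 1)) => c₀) :
              BondL2K ℂ d (towerP L (fun _ : Fin d => N n * M) (k + 1)) c₀ W ≃ₗ[ℂ] (Bond d (towerP L (fun _ : Fin d => N n * M) (k + 1)) → W)).symm.toLinearMap)).comp
        ((G' n).comp (LinearMap.toContinuousLinearMap
          ((WL2.linearEquiv ℂ ℂ (fun _ : Bond d (towerP L (fun _ : Fin d => N n * M) (k + 1)) => c₀) :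
              BondL2K ℂ d (towerP L (fun _ : Fin d => N n * M) (k + 1)) c₀ W ≃ₗ[ℂ] (Bond d (towerP L (fun _ : Fin d => N n * M) (k + 1)) → W)).toLinearMap ∘ₗ
            LinearMap.adjoint (QkW L (fun _ : Fin d => N n * M) k φ (U n) hL (αU n) (hα1 n) (hU1 n) (hreg n) (c₀ := c₀) (c₁ := c₁)) ∘ₗ
            (WL2.linearEquiv ℂ ℂ (fun _ : Bond d (fun _ : Fin d => N n * M) => c₁) : BondL2K ℂ d (fun _ : Fin d => N n * M) c₁ W ≃ₗ[ℂ] (Bond d (fun _ : Fin d => N n * M) → W)).symm.toLinearMap)))) = 1 ∧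
      ((LinearMap.toContinuousLinearMap
          ((WL2.linearEquiv ℂ ℂ (fun _ : Bond d (fun _ : Fin d => N n * M) => c₁) : BondL2K ℂ d (fun _ : Fin d => N n * M) c₁ W ≃ₗ[ℂ] (Bond d (fun _ : Fin d => N n * M) → W)).toLinearMap ∘ₗ
            QkW L (fun _ : Fin d => N n * M) k φ (U n) hL (αU n) (hα1 n) (hU1 n) (hreg n) (c₀ := c₀) (c₁ := c₁) ∘ₗ
            (WL2.linearEquiv ℂ ℂ (fun _ : Bond d (towerP L (fun _ : Fin d => N n * M) (k + 1)) => c₀) :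
              BondL2K ℂ d (towerP L (fun _ : Fin d => N n * M) (k + 1)) c₀ W ≃ₗ[ℂ] (Bond d (towerP L (fun _ : Fin d => N n * M) (k + 1)) → W)).symm.toLinearMap)).comp
        ((G' n).comp (LinearMap.toContinuousLinearMap
          ((WL2.linearEquiv ℂ ℂ (fun _ : Bond d (towerP L (fun _ : Fin d => N n * M) (k + 1)) => c₀) :
              BondL2K ℂ d (towerP L (fun _ : Fin d => N n * M) (k + 1)) c₀ W ≃ₗ[ℂ] (Bond d (towerP L (fun _ : Fin d => N n * M) (k + 1)) → W)).toLinearMap ∘ₗ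
            LinearMap.adjoint (QkW L (fun _ : Fin d => N n * M) k φ (U n) hL (αU n) (hα1 n) (hU1 n) (hreg n) (c₀ := c₀) (c₁ := c₁)) ∘ₗ
            (WL2.linearEquiv ℂ ℂ (fun _ : Bond d (fun _ : Fin d => N n * M) => c₁) : BondL2K ℂ d (fun _ : Fin d => N n * M) c₁ W ≃ₗ[ℂ] (Bond d (fun _ : Fin d => N n * M) → W)).symm.toLinearMap)))) * Inv' n = 1 ∧
      -- the derivative family: [15] (182) at the origin, `T n = (H₀ + G̃Δ⁽²⁾H₀)ᵉ↾ℝ` with `H₀ = H₁,k(U n)`, `G̃ = G′ − G′Q_k†·Inv′·Q_kG′`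
      T n =
          ((((WL2.linearEquiv ℂ ℂ (fun _ : Bond d (towerP L (fun _ : Fin d => N n * M) (k + 1)) => c₀) :
                  BondL2K ℂ d (towerP L (fun _ : Fin d => N n * M) (k + 1)) c₀ W ≃ₗ[ℂ] (Bond d (towerP L (fun _ : Fin d => N n * M) (k + 1)) → W)).toLinearMap ∘ₗ
              H1k L (fun _ : Fin d => N n * M) k φ η (U n) hL (αU n) (hα1 n) (hU1 n) (hreg n) τ (c₀ := c₀) (c₁ := c₁) (hαL n) (hpos n) ∘ₗ
              (WL2.linearEquiv ℂ ℂ (fun _ : Bond d (fun _ : Fin d => N n * M) => c₁) : BondL2K ℂ d (fun _ : Fin d => N n * M) c₁ W ≃ₗ[ℂ] (Bond d (fun _ : Fin d => N n * M) → W)).symm.toLinearMap).restrictScalars ℝ) +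
            (((G' n).restrictScalars ℝ : (Bond d (towerP L (fun _ : Fin d => N n * M) (k + 1)) → W) →ₗ[ℝ] (Bond d (towerP L (fun _ : Fin d => N n * M) (k + 1)) → W)) -
              (((G' n).restrictScalars ℝ : (Bond d (towerP L (fun _ : Fin d => N n * M) (k + 1)) → W) →ₗ[ℝ] (Bond d (towerP L (fun _ : Fin d => N n * M) (k + 1)) → W)) ∘ₗ
                (((WL2.linearEquiv ℂ ℂ (fun _ : Bond d (towerP L (fun _ : Fin d => N n * M) (k + 1)) => c₀) :
                      BondL2K ℂ d (towerP L (fun _ : Fin d => N n * M) (k + 1)) c₀ W ≃ₗ[ℂ] (Bond d (towerP L (fun _ : Fin d => N n * M) (k + 1)) → W)).toLinearMap ∘ₗ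
                  LinearMap.adjoint (QkW L (fun _ : Fin d => N n * M) k φ (U n) hL (αU n) (hα1 n) (hU1 n) (hreg n) (c₀ := c₀) (c₁ := c₁)) ∘ₗ
                  (WL2.linearEquiv ℂ ℂ (fun _ : Bond d (fun _ : Fin d => N n * M) => c₁) : BondL2K ℂ d (fun _ : Fin d => N n * M) c₁ W ≃ₗ[ℂ] (Bond d (fun _ : Fin d => N n * M) → W)).symm.toLinearMap).restrictScalars ℝ)) ∘ₗ
              ((Inv' n).restrictScalars ℝ : (Bond d (fun _ : Fin d => N n * M) → W) →ₗ[ℝ] (Bond d (fun _ : Fin d => N n * M) → W)) ∘ₗ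
              ((((WL2.linearEquiv ℂ ℂ (fun _ : Bond d (fun _ : Fin d => N n * M) => c₁) : BondL2K ℂ d (fun _ : Fin d => N n * M) c₁ W ≃ₗ[ℂ] (Bond d (fun _ : Fin d => N n * M) → W)).toLinearMap ∘ₗ
                  QkW L (fun _ : Fin d => N n * M) k φ (U n) hL (αU n) (hα1 n) (hU1 n) (hreg n) (c₀ := c₀) (c₁ := c₁) ∘ₗ
                  (WL2.linearEquiv ℂ ℂ (fun _ : Bond d (towerP L (fun _ : Fin d => N n * M) (k + 1)) => c₀) :
                    BondL2K ℂ d (towerP L (fun _ : Fin d => N n * M) (k + 1)) c₀ W ≃ₗ[ℂ] (Bond d (towerP L (fun _ : Fin d => N n * M) (k + 1)) → W)).symm.toLinearMap).restrictScalars ℝ) ∘ₗ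
                ((G' n).restrictScalars ℝ : (Bond d (towerP L (fun _ : Fin d => N n * M) (k + 1)) → W) →ₗ[ℝ] (Bond d (towerP L (fun _ : Fin d => N n * M) (k + 1)) → W)))) ∘ₗ
            ((((WL2.linearEquiv ℂ ℂ (fun _ : Bond d (towerP L (fun _ : Fin d => N n * M) (k + 1)) => c₀) :
                    BondL2K ℂ d (towerP L (fun _ : Fin d => N n * M) (k + 1)) c₀ W ≃ₗ[ℂ] (Bond d (towerP L (fun _ : Fin d => N n * M) (k + 1)) → W)).toLinearMap ∘ₗ D2 n ∘ₗ
                (WL2.linearEquiv ℂ ℂ (fun _ : Bond d (towerP L (fun _ : Fin d => N n * M) (k + 1)) => c₀) :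
                  BondL2K ℂ d (towerP L (fun _ : Fin d => N n * M) (k + 1)) c₀ W ≃ₗ[ℂ] (Bond d (towerP L (fun _ : Fin d => N n * M) (k + 1)) → W)).symm.toLinearMap).restrictScalars ℝ) ∘ₗ
              (((WL2.linearEquiv ℂ ℂ (fun _ : Bond d (towerP L (fun _ : Fin d => N n * M) (k + 1)) => c₀) :
                    BondL2K ℂ d (towerP L (fun _ : Fin d => N n * M) (k + 1)) c₀ W ≃ₗ[ℂ] (Bond d (towerP L (fun _ : Fin d => N n * M) (k + 1)) → W)).toLinearMap ∘ₗ
                H1k L (fun _ : Fin d => N n * M) k φ η (U n) hL (αU n) (hα1 n) (hU1 n) (hreg n) τ (c₀ := c₀) (c₁ := c₁) (hαL n) (hpos n) ∘ₗ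
                (WL2.linearEquiv ℂ ℂ (fun _ : Bond d (fun _ : Fin d => N n * M) => c₁) : BondL2K ℂ d (fun _ : Fin d => N n * M) c₁ W ≃ₗ[ℂ] (Bond d (fun _ : Fin d => N n * M) → W)).symm.toLinearMap).restrictScalars ℝ)))
      ) ∧
      ∃ D : Data190 d M N (fun n => Bond d (towerP L (fun _ : Fin d => N n * M) (k + 1)) → W) q',
        ∀ (n : ℕ) (X : TDom d (N n)) (x : TPt d (N n * M)),
          D.hn n X x = fun b : Bond d (towerP L (fun _ : Fin d => N n * M) (k + 1)) =>
            if tcubeOf (N n) M (fun i => ((blockCoord (L ^ (k + 1)) (fun _ : Fin d => N n * M) (siteCast (towerP_eq_fineP_pow L (fun _ : Fin d => N n * M) (k + 1)) (bpos b)) i : ℕ) :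
                ZMod (N n * M))) ∈ X.1 then
              T n (Pi.single ((fun i => (⟨(x i).val, ZMod.val_lt (x i)⟩ : Fin (N n * M))), μ₀) w₀) b
            else 0 := by
  obtain ⟨αs, B, δ, A', r₁, α₁, j₁, Λ, hαs, hB, hδ, hA', hr₁, hα₁, hj₁, hΛ, HY⟩ :=
    exists_ineq190_origin_tower_delta2 hd L hL hL3 φ hMφ hMφ' hφ hφ' hstar ha ha' hϱ0 hϱ1 τ hτ hCτ hτm hMτ hρw hτ₁ hτ₂ hφτ AQ hAQ16 hα hα3 hα4 hβ
      hsmall hc₃ h145 h155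
  refine ⟨αs, B, δ, A', r₁, α₁, j₁, Λ, hαs, hB, hδ, hA', hr₁, hα₁, hj₁, hΛ, ?_⟩
  intro k η hηL c₀ c₁ _ _ hw hρ hc₀η M _ N _ I i₀ μ₀ w₀ U αU hα0 hα1 hαL hU1 hreg εU hεU hUε hLb α hα' hαle hαs' hUst hUb hUη hpl hUgrad
    hRlev hεg hAQ hpos' hpos j₀ hJ hj hposπ hQ η₀ L₀ M₀ R H ρ σ c hσ hρ0 hρ₁ hρI hc_def qN BG' θP qI BI' A₀ θD BGt hq_def hq hBG' hθP hqI hqI1 hBI' hA₀ hθD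
    hBGt q' δr hδr hσ₀ hcR hκB hδ15 hCst hm hθ1
  have hmN : ∀ n, ∀ i : Fin d, 1 ≤ (fun _ : Fin d => N n * M) i := fun n _ => Nat.pos_of_neZero _
  -- «Y18» per volume, then `choose`
  have HYn := fun n => HY k η hηL c₀ c₁ hw hρ (fun _ : Fin d => N n * M) (hmN n) (U n) (αU n) (hα0 n) (hα1 n) (hαL n) (hU1 n) (hreg n) (εU n) (hεU n) (hUε n)
    (hLb n) α hα' hαle (hUst n) (hUb n) (hUη n) (hpl n) (hUgrad n) (hRlev n) (hεg n) (hAQ n) (hpos' n) (hpos n) hc₀η j₀ (hJ n) hj (hposπ n) (hQ n)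
    hαs' (η₀ n) (L₀ n) (M₀ n) (R n) (H n) ρ σ c hσ hρ0 hρ₁ hρI hc_def hq_def hq hBG' hθP hqI hqI1 hBI' hA₀ hθD hBGt
  choose D2 G' Inv' h1 h2 h3 h4 h5 using HYn
  have hδ8 : q'.δ15 / 8 ≤ ρ := by linarith
  refine ⟨D2, G', Inv', fun n =>
          ((((WL2.linearEquiv ℂ ℂ (fun _ : Bond d (towerP L (fun _ : Fin d => N n * M) (k + 1)) => c₀) :
                  BondL2K ℂ d (towerP L (fun _ : Fin d => N n * M) (k + 1)) c₀ W ≃ₗ[ℂ] (Bond d (towerP L (fun _ : Fin d => N n * M) (k + 1)) → W)).toLinearMap ∘ₗ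
              H1k L (fun _ : Fin d => N n * M) k φ η (U n) hL (αU n) (hα1 n) (hU1 n) (hreg n) τ (c₀ := c₀) (c₁ := c₁) (hαL n) (hpos n) ∘ₗ
              (WL2.linearEquiv ℂ ℂ (fun _ : Bond d (fun _ : Fin d => N n * M) => c₁) : BondL2K ℂ d (fun _ : Fin d => N n * M) c₁ W ≃ₗ[ℂ] (Bond d (fun _ : Fin d => N n * M) → W)).symm.toLinearMap).restrictScalars ℝ) +
            (((G' n).restrictScalars ℝ : (Bond d (towerP L (fun _ : Fin d => N n * M) (k + 1)) → W) →ₗ[ℝ] (Bond d (towerP L (fun _ : Fin d => N n * M) (k + 1)) → W)) -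
              (((G' n).restrictScalars ℝ : (Bond d (towerP L (fun _ : Fin d => N n * M) (k + 1)) → W) →ₗ[ℝ] (Bond d (towerP L (fun _ : Fin d => N n * M) (k + 1)) → W)) ∘ₗ
                (((WL2.linearEquiv ℂ ℂ (fun _ : Bond d (towerP L (fun _ : Fin d => N n * M) (k + 1)) => c₀) :
                      BondL2K ℂ d (towerP L (fun _ : Fin d => N n * M) (k + 1)) c₀ W ≃ₗ[ℂ] (Bond d (towerP L (fun _ : Fin d => N n * M) (k + 1)) → W)).toLinearMap ∘ₗ
                  LinearMap.adjoint (QkW L (fun _ : Fin d => N n * M) k φ (U n) hL (αU n) (hα1 n) (hU1 n) (hreg n) (c₀ := c₀) (c₁ := c₁)) ∘ₗ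
                  (WL2.linearEquiv ℂ ℂ (fun _ : Bond d (fun _ : Fin d => N n * M) => c₁) : BondL2K ℂ d (fun _ : Fin d => N n * M) c₁ W ≃ₗ[ℂ] (Bond d (fun _ : Fin d => N n * M) → W)).symm.toLinearMap).restrictScalars ℝ)) ∘ₗ
              ((Inv' n).restrictScalars ℝ : (Bond d (fun _ : Fin d => N n * M) → W) →ₗ[ℝ] (Bond d (fun _ : Fin d => N n * M) → W)) ∘ₗ
              ((((WL2.linearEquiv ℂ ℂ (fun _ : Bond d (fun _ : Fin d => N n * M) => c₁) : BondL2K ℂ d (fun _ : Fin d => N n * M) c₁ W ≃ₗ[ℂ] (Bond d (fun _ : Fin d => N n * M) → W)).toLinearMap ∘ₗ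
                  QkW L (fun _ : Fin d => N n * M) k φ (U n) hL (αU n) (hα1 n) (hU1 n) (hreg n) (c₀ := c₀) (c₁ := c₁) ∘ₗ
                  (WL2.linearEquiv ℂ ℂ (fun _ : Bond d (towerP L (fun _ : Fin d => N n * M) (k + 1)) => c₀) :
                    BondL2K ℂ d (towerP L (fun _ : Fin d => N n * M) (k + 1)) c₀ W ≃ₗ[ℂ] (Bond d (towerP L (fun _ : Fin d => N n * M) (k + 1)) → W)).symm.toLinearMap).restrictScalars ℝ) ∘ₗ
                ((G' n).restrictScalars ℝ : (Bond d (towerP L (fun _ : Fin d => N n * M) (k + 1)) → W) →ₗ[ℝ] (Bond d (towerP L (fun _ : Fin d => N n * M) (k + 1)) → W)))) ∘ₗ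
            ((((WL2.linearEquiv ℂ ℂ (fun _ : Bond d (towerP L (fun _ : Fin d => N n * M) (k + 1)) => c₀) :
                    BondL2K ℂ d (towerP L (fun _ : Fin d => N n * M) (k + 1)) c₀ W ≃ₗ[ℂ] (Bond d (towerP L (fun _ : Fin d => N n * M) (k + 1)) → W)).toLinearMap ∘ₗ D2 n ∘ₗ
                (WL2.linearEquiv ℂ ℂ (fun _ : Bond d (towerP L (fun _ : Fin d => N n * M) (k + 1)) => c₀) :
                  BondL2K ℂ d (towerP L (fun _ : Fin d => N n * M) (k + 1)) c₀ W ≃ₗ[ℂ] (Bond d (towerP L (fun _ : Fin d => N n * M) (k + 1)) → W)).symm.toLinearMap).restrictScalars ℝ) ∘ₗ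
              (((WL2.linearEquiv ℂ ℂ (fun _ : Bond d (towerP L (fun _ : Fin d => N n * M) (k + 1)) => c₀) :
                    BondL2K ℂ d (towerP L (fun _ : Fin d => N n * M) (k + 1)) c₀ W ≃ₗ[ℂ] (Bond d (towerP L (fun _ : Fin d => N n * M) (k + 1)) → W)).toLinearMap ∘ₗ
                H1k L (fun _ : Fin d => N n * M) k φ η (U n) hL (αU n) (hα1 n) (hU1 n) (hreg n) τ (c₀ := c₀) (c₁ := c₁) (hαL n) (hpos n) ∘ₗ
                (WL2.linearEquiv ℂ ℂ (fun _ : Bond d (fun _ : Fin d => N n * M) => c₁) : BondL2K ℂ d (fun _ : Fin d => N n * M) c₁ W ≃ₗ[ℂ] (Bond d (fun _ : Fin d => N n * M) → W)).symm.toLinearMap).restrictScalars ℝ)))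
    , fun n => ⟨h1 n, h2 n, h3 n, h4 n, rfl⟩, ?_⟩
  exact exists_data190_tower_of_ineq190 L k M N I i₀ η₀ L₀ M₀ R H μ₀ w₀ q' _
    (fun n => ((h5 n) q'.δ15 hδ8).mono fun y v => mul_le_mul_of_nonneg_right hCst (Real.exp_pos _).le) hδr hσ₀ hcR hκB hm hθ1

end Tower

end Literature.MathematicalPhysics.QuantumFieldTheory.Balaban1983to89.Beta.RemainderData190TowerDelta2

end
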